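import Summits.RiemannHypothesis.RiemannHypothesis.Theorems.PfPersistenceMarkovCoreStability
import Summits.RiemannHypothesis.RiemannHypothesis.Theorems.PfPersistenceMarkovCoreStrictDial
import HarnessLib

/-!
# PF persistence (theory 1, edge law): THE MARKOV CORE OF A NON-NEGATIVE WEIGHT TABLE, XII —
# the RESPONSE of a table: the ground state's lag increments are intrinsic, are supergradients of
# the bottom, respond monotonically to the weights, and depend continuously on the table

Helper file (`--supports stmt-RiemannHypothesis-19953`); mechanism/rigidity campaign; no RH claims.
Twelfth file of the chain `PfPersistenceMarkovCore*` (I–VII kernel Perron–Frobenius for the Markov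
core `𝓔^w_a = tableDirichletEnergy a w` of every table `w ≥ 0` on the prime index of the window; IX the
dial law of the bottom; X stability of the ground state; XI the strict dial law).  For EVERY such table
and EVERY window `a > 0`:

* `IsCoreGround.weilIncrement_eq` — two core ground states have the same lag increments `D_t`
  (uniqueness up to a phase, file IV), so the RESPONSE `coreResponse w a t := D_t(u_w)` is well
  defined (`coreResponse_eq`); `0 ≤ coreResponse ≤ 4`, and `0 < coreResponse w a (log n)` for
  `n ≥ 2` (file XI); it sees the table only below `2a` (`coreResponse_congr_table`).
* `coreBottom_le_add_sum` — the SUPERGRADIENT INEQUALITY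
  `coreBottom w' a ≤ coreBottom w a + Σ_{index} (w' n − w n) · D_{log n}(u_w)`: the ground state of `w`
  tests the bottom of `w'`.  Consequences with no limit and no regularity:
  `sum_sub_mul_sub_weilIncrement_nonpos` — RESPONSE MONOTONICITY
  `Σ_{index} (w' n − w n)(D_{log n}(u_{w'}) − D_{log n}(u_w)) ≤ 0`; on one dial, raising the weight at
  `n₀` can only LOWER the ground state's increment at `log n₀` (`weilIncrement_update_le`,
  `coreResponse_update_antitone`); tangent bounds `coreBottom_archOnly_le_sub_sum`,
  `sum_mul_coreResponse_le_coreBottom`.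
* `tendsto_weilIncrement_of_tables`, `tendsto_coreResponse_of_tables` — along every table sequence
  with `tableDist a w_k w → 0` the responses converge (file X + `L²`-continuity of increments).

File XIII (`PfPersistenceMarkovCoreFeynmanHellmann`) turns these into the exact first-order law
`∂ coreBottom / ∂ w(n₀) = coreResponse w a (log n₀)`.  Everything holds for all members of the class
alike: structure of the class, not an invariant separating ζ's table from any other.

## References

* T. Kato, *Perturbation Theory for Linear Operators* (1966), II §6.5 (one-sided derivatives of
  eigenvalues: the eigenvector tests the perturbed operator), VII §4.6.
* R. T. Rockafellar, *Convex Analysis* (1970), §23–§25 (supergradients of concave functions;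
  cyclic monotonicity, Thm 24.8).
* M. Reed, B. Simon, *Methods of Modern Mathematical Physics IV* (1978), §XIII.12.
-/

set_option linter.dupNamespace false

noncomputable section

open MeasureTheory Set Filter
open scoped Topology ENNReal NNReal ComplexConjugate

namespace Summit.RiemannHypothesis.RiemannHypothesis.Theorems.PfPersistence

open Literature.NumberTheory.LFunctions Literature.NumberTheory.LFunctions.ConnesVanSuijlekom
open Summit.RiemannHypothesis.RiemannHypothesis.Theorems.WeilGroundStateMarkovPart

variable {a : ℝ} {w w' : ℕ → ℝ}

/-! ## §1 The response of a table: increments of the ground state are well defined -/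

/-- **Increments of core ground states are intrinsic**: two core ground states of the same table and
window have the same lag increments `D_t` (they differ by a unimodular constant a.e., file IV).
[folklore] -/
theorem IsCoreGround.weilIncrement_eq (hw : ∀ n ∈ weilPrimeIndex a, 0 ≤ w n) (ha : 0 < a)
    {u v : ℝ → ℂ} (hu : IsCoreGround w a u) (hv : IsCoreGround w a v) (t : ℝ) :
    weilIncrement u t = weilIncrement v t := by
  obtain ⟨γ, hγ, huv⟩ := hu.unique hw ha hv
  rw [weilIncrement_congr_ae huv, weilIncrement_const_mul, hγ, one_pow, one_mul]

/-- **The response of the table `w` on the window `[-a, a]` at lag `t`**: the increment `D_t(u)` of a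
core ground state `u` (any one — `coreResponse_eq`; `0` if there is none, which does not happen for a
non-negative table and `a > 0`, file VI). [folklore] -/
def coreResponse (w : ℕ → ℝ) (a t : ℝ) : ℝ := by
  classical
  exact if h : ∃ u : ℝ → ℂ, IsCoreGround w a u then weilIncrement (Classical.choose h) t else 0

/-- The response is the increment of every core ground state. [folklore] -/
theorem coreResponse_eq (hw : ∀ n ∈ weilPrimeIndex a, 0 ≤ w n) (ha : 0 < a) {u : ℝ → ℂ}
    (hu : IsCoreGround w a u) (t : ℝ) : coreResponse w a t = weilIncrement u t := by
  have h : ∃ u : ℝ → ℂ, IsCoreGround w a u := ⟨u, hu⟩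
  rw [coreResponse, dif_pos h]
  exact (Classical.choose_spec h).weilIncrement_eq hw ha hu t

/-- `0 ≤ coreResponse w a t ≤ 4` (`0 ≤ D_t ≤ 4‖u‖²` on the unit sphere). [folklore] -/
theorem coreResponse_nonneg (w : ℕ → ℝ) (a t : ℝ) : 0 ≤ coreResponse w a t := by
  unfold coreResponse
  split_ifs with h
  · exact weilIncrement_nonneg _ _
  · exact le_rfl

/-- `coreResponse w a t ≤ 4`. [folklore] -/
theorem coreResponse_le_four (w : ℕ → ℝ) (a t : ℝ) : coreResponse w a t ≤ 4 := by
  unfold coreResponse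
  split_ifs with h
  · have hu := Classical.choose_spec h
    simpa [hu.2.1] using weilIncrement_le_four_mul_of_memLp hu.1.1 t
  · norm_num

/-- **The response at every prime-power lag of the window is strictly positive**: for `n ≥ 2`,
`0 < coreResponse w a (log n)` (file XI: a core ground state charges every length). [folklore] -/
theorem coreResponse_log_pos (hw : ∀ n ∈ weilPrimeIndex a, 0 ≤ w n) (ha : 0 < a) {n : ℕ}
    (h2 : 2 ≤ n) : 0 < coreResponse w a (Real.log n) := by
  obtain ⟨u, hu⟩ := exists_isCoreGround hw ha
  rw [coreResponse_eq hw ha hu]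
  exact hu.weilIncrement_log_pos h2

/-- The response depends on the table only through its values on the prime index of the window
(twin wall, as for every object of the chain). [folklore] -/
theorem coreResponse_congr_table (h : ∀ n ∈ weilPrimeIndex a, w n = w' n) (t : ℝ) :
    coreResponse w a t = coreResponse w' a t := by
  have hP : IsCoreGround w a = IsCoreGround w' a :=
    funext fun u ↦ propext (isCoreGround_congr_table h u)
  unfold coreResponse
  rw [hP]

/-! ## §2 The supergradient inequality and response monotonicity (no limits) -/

/-- **The ground state of `w` tests the bottom of `w'`**:
`coreBottom w' a ≤ coreBottom w a + Σ_{index} (w' n − w n) D_{log n}(u)` for every core ground state `u`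
of `w` (`𝓔^{w'}(u) = 𝓔^w(u) + Σ (w' − w) D(u)` and the variational principle for `w'`). In words:
`D_{log ·}(u_w)` is a SUPERGRADIENT of the concave function `w ↦ coreBottom w a` at `w`.
[cite: Kato1966, II §6.5] -/
theorem coreBottom_le_add_sum (hw' : ∀ n ∈ weilPrimeIndex a, 0 ≤ w' n) {u : ℝ → ℂ}
    (hu : IsCoreGround w a u) :
    coreBottom w' a ≤ coreBottom w a +
      ∑ n ∈ weilPrimeIndex a, (w' n - w n) * weilIncrement u (Real.log n) := by
  have h1 : coreBottom w' a ≤ tableDirichletEnergy a w' u := coreBottom_le hw' hu.1 hu.2.1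
  have h2 := tableDirichletEnergy_sub_table a w' w u
  rw [hu.2.2] at h2
  linarith

/-- The same in response form. [cite: Kato1966, II §6.5] -/
theorem coreBottom_le_add_sum_coreResponse (hw : ∀ n ∈ weilPrimeIndex a, 0 ≤ w n)
    (hw' : ∀ n ∈ weilPrimeIndex a, 0 ≤ w' n) (ha : 0 < a) :
    coreBottom w' a ≤ coreBottom w a +
      ∑ n ∈ weilPrimeIndex a, (w' n - w n) * coreResponse w a (Real.log n) := by
  obtain ⟨u, hu⟩ := exists_isCoreGround hw ha
  simp only [coreResponse_eq hw ha hu]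
  exact coreBottom_le_add_sum hw' hu

/-- **RESPONSE MONOTONICITY** (cyclic monotonicity of the supergradient): for two non-negative tables
with core ground states `u`, `u'`, `Σ_{index} (w' n − w n) (D_{log n}(u') − D_{log n}(u)) ≤ 0`.  No
limit, no regularity: the two supergradient inequalities added. [folklore] -/
theorem sum_sub_mul_sub_weilIncrement_nonpos (hw : ∀ n ∈ weilPrimeIndex a, 0 ≤ w n)
    (hw' : ∀ n ∈ weilPrimeIndex a, 0 ≤ w' n) {u u' : ℝ → ℂ} (hu : IsCoreGround w a u)
    (hu' : IsCoreGround w' a u') :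
    ∑ n ∈ weilPrimeIndex a,
      (w' n - w n) * (weilIncrement u' (Real.log n) - weilIncrement u (Real.log n)) ≤ 0 := by
  have h1 := coreBottom_le_add_sum hw' hu
  have h2 := coreBottom_le_add_sum hw hu'
  have e : ∑ n ∈ weilPrimeIndex a,
      (w' n - w n) * (weilIncrement u' (Real.log n) - weilIncrement u (Real.log n)) =
      -(∑ n ∈ weilPrimeIndex a, (w n - w' n) * weilIncrement u' (Real.log n)) -
        ∑ n ∈ weilPrimeIndex a, (w' n - w n) * weilIncrement u (Real.log n) := by
    rw [← Finset.sum_neg_distrib, ← Finset.sum_sub_distrib]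
    exact Finset.sum_congr rfl fun n _ ↦ by ring
  rw [e]
  linarith

/-- A table edited at one index point stays non-negative. [folklore] -/
theorem update_nonneg (hw : ∀ n ∈ weilPrimeIndex a, 0 ≤ w n) (n₀ : ℕ) {s : ℝ} (hs : 0 ≤ s) :
    ∀ n ∈ weilPrimeIndex a, 0 ≤ Function.update w n₀ s n := by
  intro n hn
  rcases eq_or_ne n n₀ with rfl | hne
  · rwa [Function.update_self]
  · rw [Function.update_of_ne hne]
    exact hw n hn

/-- **One dial: raising a weight lowers the ground state's increment at that lag.**  If `w ≥ 0` on
the prime index, `n₀ ∈ weilPrimeIndex a`, `w n₀ ≤ s`, and `u`, `u'` are core ground states of `w` and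
of `update w n₀ s`, then `D_{log n₀}(u') ≤ D_{log n₀}(u)`. [folklore] -/
theorem weilIncrement_update_le (hw : ∀ n ∈ weilPrimeIndex a, 0 ≤ w n) (ha : 0 < a) {n₀ : ℕ}
    (hn₀ : n₀ ∈ weilPrimeIndex a) {s : ℝ} (hs : w n₀ ≤ s) {u u' : ℝ → ℂ} (hu : IsCoreGround w a u)
    (hu' : IsCoreGround (Function.update w n₀ s) a u') :
    weilIncrement u' (Real.log n₀) ≤ weilIncrement u (Real.log n₀) := by
  have hws : ∀ n ∈ weilPrimeIndex a, 0 ≤ Function.update w n₀ s n :=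
    update_nonneg hw n₀ ((hw n₀ hn₀).trans hs)
  have key := sum_sub_mul_sub_weilIncrement_nonpos hw hws hu hu'
  rw [Finset.sum_eq_single_of_mem n₀ hn₀ (fun n _ hne ↦ by
    rw [Function.update_of_ne hne, sub_self, zero_mul]), Function.update_self] at key
  rcases hs.lt_or_eq with hlt | heq
  · exact sub_nonpos.1 (nonpos_of_mul_nonpos_right key (sub_pos.2 hlt))
  · -- `s = w n₀`: the edited table is `w` itself and the increments agree
    have hu'' : IsCoreGround w a u' := by
      rw [← heq, Function.update_eq_self] at hu'
      exact hu'
    exact (hu''.weilIncrement_eq hw ha hu _).le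

/-- **The response along a dial is antitone**: for `n₀ ∈ weilPrimeIndex a` and `0 ≤ s ≤ s'`,
`coreResponse (update w n₀ s') a (log n₀) ≤ coreResponse (update w n₀ s) a (log n₀)`. [folklore] -/
theorem coreResponse_update_antitone (hw : ∀ n ∈ weilPrimeIndex a, 0 ≤ w n) (ha : 0 < a) {n₀ : ℕ}
    (hn₀ : n₀ ∈ weilPrimeIndex a) :
    AntitoneOn (fun s ↦ coreResponse (Function.update w n₀ s) a (Real.log n₀)) (Ici 0) := by
  intro s hs s' hs' hss'
  have hws : ∀ n ∈ weilPrimeIndex a, 0 ≤ Function.update w n₀ s n := update_nonneg hw n₀ hs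
  have hws' : ∀ n ∈ weilPrimeIndex a, 0 ≤ Function.update w n₀ s' n := update_nonneg hw n₀ hs'
  obtain ⟨u, hu⟩ := exists_isCoreGround hws ha
  obtain ⟨u', hu'⟩ := exists_isCoreGround hws' ha
  simp only [coreResponse_eq hws ha hu, coreResponse_eq hws' ha hu']
  have hu'2 : IsCoreGround (Function.update (Function.update w n₀ s) n₀ s') a u' := by
    rwa [Function.update_idem]
  exact weilIncrement_update_le hws ha hn₀ (by rwa [Function.update_self]) hu hu'2

/-! ## §3 Continuity of the response along convergent tables (file X) -/

/-- **Increments of the ground state depend continuously on the table**: along `tableDist a w_k w → 0`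
(non-negative tables) and for ANY choices of core ground states `u_k` of `w_k` and `u` of `w`,
`D_t(u_k) → D_t(u)` for every lag `t` (file X gives `u_k → u` in `L²` modulo unimodular constants; the
increments do not see the constants and are `L²`-continuous). [folklore] -/
theorem tendsto_weilIncrement_of_tables (hw : ∀ n ∈ weilPrimeIndex a, 0 ≤ w n) {wk : ℕ → ℕ → ℝ}
    (hwk : ∀ k, ∀ n ∈ weilPrimeIndex a, 0 ≤ wk k n) (ha : 0 < a)
    (hd : Tendsto (fun k ↦ tableDist a (wk k) w) atTop (𝓝 0))
    {u : ℝ → ℂ} (hu : IsCoreGround w a u) {uk : ℕ → ℝ → ℂ}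
    (huk : ∀ k, IsCoreGround (wk k) a (uk k)) (t : ℝ) :
    Tendsto (fun k ↦ weilIncrement (uk k) t) atTop (𝓝 (weilIncrement u t)) := by
  obtain ⟨c, hc, hlim⟩ := hu.tendsto_of_tables hw hwk ha hd huk
  have h := tendsto_weilIncrement_of_tendsto hu.1.1 (fun k ↦ (huk k).1.1.const_mul (c k)) hlim t
  refine h.congr fun k ↦ ?_
  rw [weilIncrement_const_mul, hc k, one_pow, one_mul]

/-- The same in response form: `coreResponse (w_k) a t → coreResponse w a t`. [folklore] -/
theorem tendsto_coreResponse_of_tables (hw : ∀ n ∈ weilPrimeIndex a, 0 ≤ w n) {wk : ℕ → ℕ → ℝ}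
    (hwk : ∀ k, ∀ n ∈ weilPrimeIndex a, 0 ≤ wk k n) (ha : 0 < a)
    (hd : Tendsto (fun k ↦ tableDist a (wk k) w) atTop (𝓝 0)) (t : ℝ) :
    Tendsto (fun k ↦ coreResponse (wk k) a t) atTop (𝓝 (coreResponse w a t)) := by
  classical
  obtain ⟨u, hu⟩ := exists_isCoreGround hw ha
  have huk : ∀ k, IsCoreGround (wk k) a (Classical.choose (exists_isCoreGround (hwk k) ha)) :=
    fun k ↦ Classical.choose_spec (exists_isCoreGround (hwk k) ha)
  have h := tendsto_weilIncrement_of_tables hw hwk ha hd hu huk t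
  rw [coreResponse_eq hw ha hu]
  exact h.congr fun k ↦ (coreResponse_eq (hwk k) ha (huk k) t).symm

/-! ## §4 Tangent bounds -/

/-- **The core bottom lies below every tangent plane** (concavity in differential form): for
non-negative tables `w, w'`,
`coreBottom w' a ≤ coreBottom w a + Σ_{index} (w' n − w n) · ∂_n coreBottom (w)`, the partial
derivatives being the responses `coreResponse w a (log n)`. At `w' = 0`: the arch-only bottom is at most
`coreBottom w a − Σ w n · R_w(log n)`. [folklore] -/
theorem coreBottom_archOnly_le_sub_sum (hw : ∀ n ∈ weilPrimeIndex a, 0 ≤ w n) (ha : 0 < a) :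
    coreBottom (fun _ ↦ 0) a ≤
      coreBottom w a - ∑ n ∈ weilPrimeIndex a, w n * coreResponse w a (Real.log n) := by
  have h := coreBottom_le_add_sum_coreResponse hw (w' := fun _ ↦ 0) (fun _ _ ↦ le_rfl) ha
  have e : ∑ n ∈ weilPrimeIndex a, ((0 : ℝ) - w n) * coreResponse w a (Real.log n) =
      -∑ n ∈ weilPrimeIndex a, w n * coreResponse w a (Real.log n) := by
    rw [← Finset.sum_neg_distrib]
    exact Finset.sum_congr rfl fun n _ ↦ by ring
  rw [e] at h
  linarith

/-- **Euler splitting of the bottom at the ground state**: `coreBottom w a = Σ_{index} w n R_w(log n) +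
(archimedean energy of the ground state)`, so the prime part `Σ w n ∂_n coreBottom(w)` never exceeds
the bottom. [folklore] -/
theorem sum_mul_coreResponse_le_coreBottom (hw : ∀ n ∈ weilPrimeIndex a, 0 ≤ w n) (ha : 0 < a) :
    ∑ n ∈ weilPrimeIndex a, w n * coreResponse w a (Real.log n) ≤ coreBottom w a := by
  obtain ⟨u, hu⟩ := exists_isCoreGround hw ha
  simp only [coreResponse_eq hw ha hu]
  rw [← hu.2.2, tableDirichletEnergy]
  have harch : 0 ≤ ∫ t in Ioi (0 : ℝ), weilArchDensity t * weilIncrement u t :=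
    setIntegral_nonneg measurableSet_Ioi fun t ht ↦
      mul_nonneg (weilArchDensity_pos ht).le (weilIncrement_nonneg u t)
  linarith

end Summit.RiemannHypothesis.RiemannHypothesis.Theorems.PfPersistence

end
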